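import Mathlib
import HarnessLib
import Summits.NavierStokesRegularity.NavierStokesRegularity.Theorems.PoloidalWindowDoorPoloidalWindowRigiditySparseEnergyEnvRound
import Summits.NavierStokesRegularity.NavierStokesRegularity.Theorems.PoloidalWindowDoorPoloidalWindowRigiditySparseEnergyRoundStep

/-!
# Route `PoloidalWindowDoor`, crux `PoloidalWindowRigidity` (stmt-19708), line `sparse_energy` (cstrat g11) —
# stub S1 `stub_scaledEnergy`, near-apex half: THE THREE ROUNDS `γ = 17/16 → 5/8 → 1/8 → 0`

Seat ns-poloidal-K2-p2 g9 (successor of the interim LEAD-of-record on 19708; file `--supports`).  The near-apex bootstrap of the line card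
(`Cruxes/PoloidalWindowRigidity/Lines/sparse_energy.md`, S1 (b)–(c)) in the POWER-LAW form: the envelope
`IH(γ, K) : ∀ a ρ t, 0 < ρ → t < 0 → −t ≤ ρ² → ∫ cutoff ρ (a − ·)|v t|² ≤ K·ρ·(ρ²/(−t))^γ` is improved by one application of
`…SparseEnergyEnvRound.envelope_round` + `…SparseEnergyRoundStep.round_rhs_le_envelope` from `γ` to any
`γ' ≥ max(γ−1,0), max(γ−½,0), max(3γ/2−1,0)`:

* `ih_start` — `IH(17/16, A+B)` from the class bound `∫ cutoff ρ|v t|² ≤ Aρ²/√(−t) + Bρ³/(−t)` (`…FarField.cutoffEnergy_dissipation_le`);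
* `ih_step` — `IH(γ,K)` + the WINDOW PRESSURE SPLIT (hypothesis `hwin`, consumer form agreed with ns-es-p1: per window `(T,0)` a classical
  pressure `q` with, on every ball `B̄(a,2R)` and slice `t`, `q t = c + p₁ + p₂`, `‖p₁‖_{L²(B̄(a,2R))} ≤ κ₁(C/√(−t))√E(a,8R,t)`,
  `osc p₂ ≤ κ₂R·Σ'_k((2^kR)⁻¹)⁴E(a,2^{k+1}R,t)`) ⇒ `IH(γ',K')` AND the cut-off dissipation bound
  `2∫_{−ρ²}^{t₀}∫|Dv|²_F·cutoff ρ (a−·) ≤ K'ρ(ρ²/(−t₀))^{γ'}` on `−ρ² < t₀ < 0`;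
* `envelope_zero` — three steps (`17/16 → 5/8 → 1/8 → 0`): a UNIFORM bound `K₃·ρ` for the cut-off energy on the near regime and for the
  cut-off dissipation over `(−ρ², t₀)`, i.e. everything S1 needs near the apex, CONDITIONAL on `hwin` (the Literature brick
  `RieszPressureModConst` / `BoundedMildPressureIdentification` being typed by ns-es-p1 discharges `hwin` for the Type-I class).

WHAT THIS IS NOT: not a claim about Navier–Stokes regularity or blow-up; a conditional (on `hwin`) local-energy estimate for time-Type-I bounded ancient
mild solutions (bears_on LADDER-NS N0 via crux 19708, line sparse_energy, stub S1). [folklore]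
-/

noncomputable section

-- the summit and its single sub-problem share the name (CONVENTIONS §1), as in every Theorems file
set_option linter.dupNamespace false

namespace Summit.NavierStokesRegularity.NavierStokesRegularity.Theorems.PoloidalWindowDoorPoloidalWindowRigiditySparseEnergyRounds

open MeasureTheory Set Function Filter Topology Metric intervalIntegral
open scoped RealInnerProductSpace InnerProductSpace Laplacian ENNReal
open Literature.Analysis Literature.Analysis.FluidPDE
open Summit.NavierStokesRegularity.NavierStokesRegularity.Theorems.PoloidalWindowDoorPoloidalWindowRigiditySparseEnergyFarField
open Summit.NavierStokesRegularity.NavierStokesRegularity.Theorems.PoloidalWindowDoorPoloidalWindowRigiditySparseEnergyEnvRound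
open Summit.NavierStokesRegularity.NavierStokesRegularity.Theorems.PoloidalWindowDoorPoloidalWindowRigiditySparseEnergyRoundStep

variable {C : ℝ} {v : ℝ → EuclideanSpace ℝ (Fin 3) → EuclideanSpace ℝ (Fin 3)}

/-- **START OF THE BOOTSTRAP**: the class bound `∫ cutoff ρ (a−·)|v t|² ≤ Aρ²/√(−t) + Bρ³/(−t)` read on the near regime `−t ≤ ρ²`
(`x = ρ²/(−t) ≥ 1`, `√x, x ≤ x^{17/16}`) is the envelope `IH(17/16, A+B)`. [folklore] -/
theorem ih_start (hrate : HasTypeITimeDecay C v)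
    (hcont : ContinuousOn (uncurry v) (Iio (0 : ℝ) ×ˢ univ))
    (hmild : ∀ s t : ℝ, s < t → t < 0 → ∀ x,
      v t x = UnboundedOperators.heatExtension (v s) (t - s) x - oseenDuhamel 1 s v v t x)
    (hdiv : ∀ t < 0, VectorCalculus.IsDivFree (v t)) :
    ∃ K : ℝ, 0 ≤ K ∧ ∀ (a : EuclideanSpace ℝ (Fin 3)) (ρ t : ℝ), 0 < ρ → t < 0 → -t ≤ ρ ^ 2 →
      ∫ x, cutoff ρ (a - x) * ‖v t x‖ ^ 2 ≤ K * ρ * (ρ ^ 2 / (-t)) ^ (17 / 16 : ℝ) := by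
  obtain ⟨A, B, hA, hB, h⟩ := cutoffEnergy_dissipation_le hrate hcont hmild hdiv
  refine ⟨A + B, by positivity, fun a ρ t hρ ht hnear => ?_⟩
  obtain ⟨hE, -⟩ := h a ρ hρ (t - 1) t (by linarith) ht
  have hτ : 0 < -t := neg_pos.2 ht
  have hx1 : 1 ≤ ρ ^ 2 / (-t) := (one_le_div hτ).2 hnear
  have hsx : Real.sqrt (ρ ^ 2 / (-t)) = ρ / Real.sqrt (-t) := by
    rw [Real.sqrt_div (sq_nonneg ρ), Real.sqrt_sq hρ.le]
  have h1 : A * ρ ^ 2 / Real.sqrt (-t) = A * ρ * Real.sqrt (ρ ^ 2 / (-t)) := by rw [hsx]; ring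
  have h2 : B * ρ ^ 3 / (-t) = B * ρ * (ρ ^ 2 / (-t)) := by ring
  have hs_le : Real.sqrt (ρ ^ 2 / (-t)) ≤ (ρ ^ 2 / (-t)) ^ (17 / 16 : ℝ) := by
    rw [Real.sqrt_eq_rpow]; exact Real.rpow_le_rpow_of_exponent_le hx1 (by norm_num)
  have hx_le : ρ ^ 2 / (-t) ≤ (ρ ^ 2 / (-t)) ^ (17 / 16 : ℝ) := by
    conv_lhs => rw [← Real.rpow_one (ρ ^ 2 / (-t))]
    exact Real.rpow_le_rpow_of_exponent_le hx1 (by norm_num)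
  calc ∫ x, cutoff ρ (a - x) * ‖v t x‖ ^ 2 ≤ A * ρ ^ 2 / Real.sqrt (-t) + B * ρ ^ 3 / (-t) := hE
    _ = A * ρ * Real.sqrt (ρ ^ 2 / (-t)) + B * ρ * (ρ ^ 2 / (-t)) := by rw [h1, h2]
    _ ≤ A * ρ * (ρ ^ 2 / (-t)) ^ (17 / 16 : ℝ) + B * ρ * (ρ ^ 2 / (-t)) ^ (17 / 16 : ℝ) :=
      add_le_add (mul_le_mul_of_nonneg_left hs_le (by positivity)) (mul_le_mul_of_nonneg_left hx_le (by positivity))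
    _ = (A + B) * ρ * (ρ ^ 2 / (-t)) ^ (17 / 16 : ℝ) := by ring

/-- **ONE ROUND OF THE BOOTSTRAP**: under the window pressure split `hwin` (see the file header), the envelope `IH(γ, K)`
(`0 ≤ γ < 3/2`, `γ ∉ {1, ½, ⅔}`) improves to `IH(γ', K')` for every `γ' ≥ max(γ−1,0), max(γ−½,0), max(3γ/2−1,0)`, and the same
`K'ρ(ρ²/(−t₀))^{γ'}` bounds the cut-off dissipation `2∫_{−ρ²}^{t₀}∫|Dv|²_F·cutoff ρ (a−·)` for `−ρ² < t₀ < 0`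
(`envelope_round` on the window `(−ρ², t₀]` with the pressure of the window `(−ρ²−1, 0)`, `round_rhs_le_envelope`, and the class bound
at the endpoint `t₀ = −ρ²`). [folklore] -/
theorem ih_step (hrate : HasTypeITimeDecay C v)
    (hcont : ContinuousOn (uncurry v) (Iio (0 : ℝ) ×ˢ univ))
    (hmild : ∀ s t : ℝ, s < t → t < 0 → ∀ x,
      v t x = UnboundedOperators.heatExtension (v s) (t - s) x - oseenDuhamel 1 s v v t x)
    (hdiv : ∀ t < 0, VectorCalculus.IsDivFree (v t)) {Cl Cg : ℝ}
    (hCl : ∀ R : ℝ, 0 < R → ∀ x : EuclideanSpace ℝ (Fin 3), |(Δ (cutoff R : EuclideanSpace ℝ (Fin 3) → ℝ)) x| ≤ Cl / R ^ 2)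
    (hCg : ∀ R : ℝ, 0 < R → ∀ x : EuclideanSpace ℝ (Fin 3), ‖fderiv ℝ (cutoff R : EuclideanSpace ℝ (Fin 3) → ℝ) x‖ ≤ Cg / R)
    {κ₁ κ₂ : ℝ} (hκ₁ : 0 ≤ κ₁) (hκ₂ : 0 ≤ κ₂)
    (hwin : ∀ T : ℝ, T < 0 → ∃ q : ℝ → EuclideanSpace ℝ (Fin 3) → ℝ, IsClassicalNSSolutionOn (Ioo T 0) 1 0 v q ∧
      ∀ t ∈ Ioo T 0, ∀ (a : EuclideanSpace ℝ (Fin 3)) (R : ℝ), 0 < R →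
        ∃ (c : ℝ) (p₁ p₂ : EuclideanSpace ℝ (Fin 3) → ℝ), Continuous p₁ ∧ (∀ x ∈ closedBall a (2 * R), q t x = c + p₁ x + p₂ x) ∧
          Real.sqrt (∫ x in closedBall a (2 * R), p₁ x ^ 2) ≤
            κ₁ * (C / Real.sqrt (-t)) * Real.sqrt (∫ x, cutoff (8 * R) (a - x) * ‖v t x‖ ^ 2) ∧
          ∃ O : ℝ, 0 ≤ O ∧ (∀ x ∈ closedBall a (2 * R), ∀ y ∈ closedBall a (2 * R), |p₂ x - p₂ y| ≤ O) ∧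
            O ≤ κ₂ * R * ∑' k : ℕ, ((2 : ℝ) ^ k * R)⁻¹ ^ 4 * ∫ x, cutoff ((2 : ℝ) ^ (k + 1) * R) (a - x) * ‖v t x‖ ^ 2)
    {K γ γ' : ℝ} (hK : 0 ≤ K) (hγ0 : 0 ≤ γ) (hγ32 : γ < 3 / 2) (hγ1 : γ ≠ 1) (hγ2 : γ ≠ 1 / 2) (hγ3 : γ ≠ 2 / 3)
    (he₁ : max (γ - 1) 0 ≤ γ') (he₂ : max (γ + 1 / 2 - 1) 0 ≤ γ') (he₃ : max (3 * γ / 2 - 1) 0 ≤ γ')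
    (IH : ∀ (a : EuclideanSpace ℝ (Fin 3)) (ρ t : ℝ), 0 < ρ → t < 0 → -t ≤ ρ ^ 2 →
      ∫ x, cutoff ρ (a - x) * ‖v t x‖ ^ 2 ≤ K * ρ * (ρ ^ 2 / (-t)) ^ γ) :
    ∃ K' : ℝ, 0 ≤ K' ∧
      (∀ (a : EuclideanSpace ℝ (Fin 3)) (ρ t : ℝ), 0 < ρ → t < 0 → -t ≤ ρ ^ 2 →
        ∫ x, cutoff ρ (a - x) * ‖v t x‖ ^ 2 ≤ K' * ρ * (ρ ^ 2 / (-t)) ^ γ') ∧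
      (∀ (a : EuclideanSpace ℝ (Fin 3)) (ρ t₀ : ℝ), 0 < ρ → -ρ ^ 2 < t₀ → t₀ < 0 →
        2 * ∫ t in (-ρ ^ 2)..t₀, ∫ x, frobeniusNormSq (fderiv ℝ (v t) x) * cutoff ρ (a - x) ≤ K' * ρ * (ρ ^ 2 / (-t₀)) ^ γ') := by
  obtain ⟨A, B, hA, hB, hround⟩ := envelope_round hrate hcont hmild hdiv hCl hCg
  obtain ⟨A', B', hA', hB', htriv⟩ := cutoffEnergy_dissipation_le hrate hcont hmild hdiv
  have hC0 : 0 ≤ C := by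
    have h := hrate (-1) (by norm_num) 0
    rw [neg_neg, Real.sqrt_one, div_one] at h
    exact (norm_nonneg _).trans h
  have hCl0 : 0 ≤ Cl := by
    have h := hCl 1 one_pos 0
    rw [one_pow, div_one] at h
    exact (abs_nonneg _).trans h
  have hCg0 : 0 ≤ Cg := by
    have h := hCg 1 one_pos 0
    rw [div_one] at h
    exact (norm_nonneg _).trans h
  have hcf0 : 0 ≤ (2 : ℝ) ^ (1 + 2 * γ) / (1 - (2 : ℝ) ^ ((1 + 2 * γ) - 4)) := by
    have h1 : (2 : ℝ) ^ ((1 + 2 * γ) - 4) < 1 := Real.rpow_lt_one_of_one_lt_of_neg one_lt_two (by linarith)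
    exact div_nonneg (Real.rpow_nonneg zero_le_two _) (by linarith)
  -- the three coefficients of the round
  set a₁ : ℝ := K * ((2 : ℝ) ^ (1 + 2 * γ) * Cl) with ha₁
  set a₂ : ℝ := K * ((2 : ℝ) ^ (1 + 2 * γ) * Cg + 2 * Cg * κ₁ * Real.sqrt ((8 : ℝ) ^ (1 + 2 * γ) * (2 : ℝ) ^ (1 + 2 * γ))) * C
    with ha₂
  set a₃ : ℝ := (2 * Cg * κ₂ * ((2 : ℝ) ^ (1 + 2 * γ) / (1 - (2 : ℝ) ^ ((1 + 2 * γ) - 4))) *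
      Real.sqrt (8 * (volume (ball (0 : EuclideanSpace ℝ (Fin 3)) 1)).toReal * (2 : ℝ) ^ (1 + 2 * γ))) * K * Real.sqrt K with ha₃
  have ha₁0 : 0 ≤ a₁ := by positivity
  have ha₂0 : 0 ≤ a₂ := by positivity
  have ha₃0 : 0 ≤ a₃ := by positivity
  set K' : ℝ := A' + B' + (A + B + a₁ / |1 - γ| + a₂ / |1 - (γ + 1 / 2)| + a₃ / |1 - 3 * γ / 2|) with hK'
  have hsum0 : 0 ≤ A + B + a₁ / |1 - γ| + a₂ / |1 - (γ + 1 / 2)| + a₃ / |1 - 3 * γ / 2| := by positivity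
  have hK'0 : 0 ≤ K' := by positivity
  -- nonnegativity of the two players
  have hE0 : ∀ (a : EuclideanSpace ℝ (Fin 3)) (ρ t : ℝ), 0 ≤ ∫ x, cutoff ρ (a - x) * ‖v t x‖ ^ 2 := fun a ρ t =>
    integral_nonneg fun x => mul_nonneg (cutoff_nonneg _ _) (sq_nonneg _)
  have hD0 : ∀ (a : EuclideanSpace ℝ (Fin 3)) (ρ t₀ : ℝ), -ρ ^ 2 ≤ t₀ →
      0 ≤ 2 * ∫ t in (-ρ ^ 2)..t₀, ∫ x, frobeniusNormSq (fderiv ℝ (v t) x) * cutoff ρ (a - x) := fun a ρ t₀ h =>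
    mul_nonneg zero_le_two (intervalIntegral.integral_nonneg h fun t _ =>
      integral_nonneg fun x => mul_nonneg (frobeniusNormSq_nonneg _) (cutoff_nonneg _ _))
  -- the round on the window `(−ρ², t₀]`
  have key : ∀ (a : EuclideanSpace ℝ (Fin 3)) (ρ t₀ : ℝ), 0 < ρ → -ρ ^ 2 < t₀ → t₀ < 0 →
      (∫ x, cutoff ρ (a - x) * ‖v t₀ x‖ ^ 2) + 2 * ∫ t in (-ρ ^ 2)..t₀, ∫ x, frobeniusNormSq (fderiv ℝ (v t) x) * cutoff ρ (a - x) ≤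
        K' * ρ * (ρ ^ 2 / (-t₀)) ^ γ' := by
    intro a ρ t₀ hρ ht₀l ht₀
    have hτ : 0 < -t₀ := neg_pos.2 ht₀
    have hx : 1 ≤ ρ ^ 2 / (-t₀) := (one_le_div hτ).2 (by linarith)
    obtain ⟨q, hcl, hsplit⟩ := hwin (-ρ ^ 2 - 1) (by nlinarith)
    have h := hround (-ρ ^ 2 - 1) q hcl κ₁ κ₂ hκ₁ hκ₂ hsplit K γ hK hγ0 hγ32 hγ1 hγ2 hγ3 IH a ρ hρ (by linarith) t₀ ht₀l ht₀
    refine h.trans ((round_rhs_le_envelope hA hB ha₁0 ha₂0 ha₃0 hρ ht₀ hx hγ1 hγ2 hγ3 he₁ he₂ he₃).trans ?_)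
    have hxp : 0 ≤ ρ * (ρ ^ 2 / (-t₀)) ^ γ' := mul_nonneg hρ.le (Real.rpow_nonneg (by positivity) _)
    have := mul_le_mul_of_nonneg_right (show A + B + a₁ / |1 - γ| + a₂ / |1 - (γ + 1 / 2)| + a₃ / |1 - 3 * γ / 2| ≤ K' by
      rw [hK']; linarith) hxp
    simpa only [mul_assoc] using this
  refine ⟨K', hK'0, fun a ρ t hρ ht hnear => ?_, fun a ρ t₀ hρ ht₀l ht₀ => ?_⟩
  · -- the energy envelope: endpoint by the class bound, interior by the round
    have hτ : 0 < -t := neg_pos.2 ht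
    have hγ' : 0 ≤ γ' := le_trans (le_max_right _ _) he₁
    have hx1 : 1 ≤ (ρ ^ 2 / (-t)) ^ γ' := Real.one_le_rpow ((one_le_div hτ).2 hnear) hγ'
    rcases eq_or_lt_of_le hnear with heq | hlt
    · obtain ⟨hE, -⟩ := htriv a ρ hρ (t - 1) t (by linarith) ht
      have e1 : A' * ρ ^ 2 / Real.sqrt (-t) + B' * ρ ^ 3 / (-t) = (A' + B') * ρ := by
        rw [heq, Real.sqrt_sq hρ.le]; field_simp
      rw [e1] at hE
      refine hE.trans ?_
      have h1 : (A' + B') * ρ ≤ K' * ρ := mul_le_mul_of_nonneg_right (by rw [hK']; linarith) hρ.le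
      exact h1.trans (by simpa only [mul_one] using mul_le_mul_of_nonneg_left hx1 (mul_nonneg hK'0 hρ.le))
    · have h := key a ρ t hρ (by linarith) ht
      linarith [hD0 a ρ t (by linarith)]
  · have h := key a ρ t₀ hρ ht₀l ht₀
    linarith [hE0 a ρ t₀]

/-- **THE NEAR-APEX ENVELOPE AT EXPONENT ZERO** (three rounds `17/16 → 5/8 → 1/8 → 0`): under the window pressure split `hwin` there is
`K₃ ≥ 0` with `∫ cutoff ρ (a−·)|v t|² ≤ K₃ρ` whenever `−t ≤ ρ²`, and `2∫_{−ρ²}^{t₀}∫|Dv|²_F·cutoff ρ (a−·) ≤ K₃ρ` whenever `−ρ² < t₀ < 0`.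
This is the whole near-apex content of S1 (`stub_scaledEnergy`), conditional on `hwin`. [folklore] -/
theorem envelope_zero (hrate : HasTypeITimeDecay C v)
    (hcont : ContinuousOn (uncurry v) (Iio (0 : ℝ) ×ˢ univ))
    (hmild : ∀ s t : ℝ, s < t → t < 0 → ∀ x,
      v t x = UnboundedOperators.heatExtension (v s) (t - s) x - oseenDuhamel 1 s v v t x)
    (hdiv : ∀ t < 0, VectorCalculus.IsDivFree (v t)) {κ₁ κ₂ : ℝ} (hκ₁ : 0 ≤ κ₁) (hκ₂ : 0 ≤ κ₂)
    (hwin : ∀ T : ℝ, T < 0 → ∃ q : ℝ → EuclideanSpace ℝ (Fin 3) → ℝ, IsClassicalNSSolutionOn (Ioo T 0) 1 0 v q ∧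
      ∀ t ∈ Ioo T 0, ∀ (a : EuclideanSpace ℝ (Fin 3)) (R : ℝ), 0 < R →
        ∃ (c : ℝ) (p₁ p₂ : EuclideanSpace ℝ (Fin 3) → ℝ), Continuous p₁ ∧ (∀ x ∈ closedBall a (2 * R), q t x = c + p₁ x + p₂ x) ∧
          Real.sqrt (∫ x in closedBall a (2 * R), p₁ x ^ 2) ≤
            κ₁ * (C / Real.sqrt (-t)) * Real.sqrt (∫ x, cutoff (8 * R) (a - x) * ‖v t x‖ ^ 2) ∧
          ∃ O : ℝ, 0 ≤ O ∧ (∀ x ∈ closedBall a (2 * R), ∀ y ∈ closedBall a (2 * R), |p₂ x - p₂ y| ≤ O) ∧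
            O ≤ κ₂ * R * ∑' k : ℕ, ((2 : ℝ) ^ k * R)⁻¹ ^ 4 * ∫ x, cutoff ((2 : ℝ) ^ (k + 1) * R) (a - x) * ‖v t x‖ ^ 2) :
    ∃ K₃ : ℝ, 0 ≤ K₃ ∧
      (∀ (a : EuclideanSpace ℝ (Fin 3)) (ρ t : ℝ), 0 < ρ → t < 0 → -t ≤ ρ ^ 2 →
        ∫ x, cutoff ρ (a - x) * ‖v t x‖ ^ 2 ≤ K₃ * ρ) ∧
      (∀ (a : EuclideanSpace ℝ (Fin 3)) (ρ t₀ : ℝ), 0 < ρ → -ρ ^ 2 < t₀ → t₀ < 0 →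
        2 * ∫ t in (-ρ ^ 2)..t₀, ∫ x, frobeniusNormSq (fderiv ℝ (v t) x) * cutoff ρ (a - x) ≤ K₃ * ρ) := by
  obtain ⟨Cl, -, hCl⟩ := exists_abs_laplacian_cutoff_le (E := EuclideanSpace ℝ (Fin 3))
  obtain ⟨Cg, -, hCg⟩ := exists_norm_fderiv_cutoff_le (E := EuclideanSpace ℝ (Fin 3))
  obtain ⟨K₀, hK₀, IH₀⟩ := ih_start hrate hcont hmild hdiv
  -- round 1: 17/16 → 5/8
  obtain ⟨K₁, hK₁, IH₁, -⟩ := ih_step hrate hcont hmild hdiv hCl hCg hκ₁ hκ₂ hwin (γ := 17 / 16) (γ' := 5 / 8) hK₀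
    (by norm_num) (by norm_num) (by norm_num) (by norm_num) (by norm_num)
    (max_le (by norm_num) (by norm_num)) (max_le (by norm_num) (by norm_num)) (max_le (by norm_num) (by norm_num)) IH₀
  -- round 2: 5/8 → 1/8
  obtain ⟨K₂, hK₂, IH₂, -⟩ := ih_step hrate hcont hmild hdiv hCl hCg hκ₁ hκ₂ hwin (γ := 5 / 8) (γ' := 1 / 8) hK₁
    (by norm_num) (by norm_num) (by norm_num) (by norm_num) (by norm_num)
    (max_le (by norm_num) (by norm_num)) (max_le (by norm_num) (by norm_num)) (max_le (by norm_num) (by norm_num)) IH₁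
  -- round 3: 1/8 → 0
  obtain ⟨K₃, hK₃, IH₃, D₃⟩ := ih_step hrate hcont hmild hdiv hCl hCg hκ₁ hκ₂ hwin (γ := 1 / 8) (γ' := 0) hK₂
    (by norm_num) (by norm_num) (by norm_num) (by norm_num) (by norm_num)
    (max_le (by norm_num) (by norm_num)) (max_le (by norm_num) (by norm_num)) (max_le (by norm_num) (by norm_num)) IH₂
  refine ⟨K₃, hK₃, fun a ρ t hρ ht hnear => ?_, fun a ρ t₀ hρ ht₀l ht₀ => ?_⟩
  · simpa only [Real.rpow_zero, mul_one] using IH₃ a ρ t hρ ht hnear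
  · simpa only [Real.rpow_zero, mul_one] using D₃ a ρ t₀ hρ ht₀l ht₀

end Summit.NavierStokesRegularity.NavierStokesRegularity.Theorems.PoloidalWindowDoorPoloidalWindowRigiditySparseEnergyRounds

end
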